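import Literature.Analysis.FluidPDE.SereginSverak2002PressureLowerBound
import HarnessLib

/-!
# Route FrozenSignCascade · crux `BoundedEnvelopeContinuation` — stub `stub_recordSequence`

Helper file for statement item stmt-NavierStokesRegularity-10579 (`BoundedEnvelopeContinuation`,
conjunct (B) of route `FrozenSignCascade`); lands `--supports` that item (line `registered`,
stub `stub_recordSequence` of the skeleton `Cruxes/BoundedEnvelopeContinuation/Lines/birth.lean`,
reshape r3: the Koch–Nadirashvili–Seregin–Šverák record zoom).

**Record points (pure real analysis).** Let `u : [0, T) × ℝ³ → ℝ³` (`T > 0`) be continuous,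
bounded on every closed sub-slab `[0, t] × ℝ³` (`t < T`), and NOT backward bounded at the
final-time point `(T, x₀)` (`¬ IsBackwardBoundedAt u T x₀`: `u` is unbounded on every backward
cylinder `(T - r², T) × B(x₀, r)`). Then there are base times `tc n > 0`, centres `xc n`, levels
`Λ n = ‖u (tc n) (xc n)‖ > 0` and slack `e n > 0` with `tc n + e n < T`, such that
`‖u‖ ≤ 2 Λ n` on `[0, tc n + e n] × ℝ³`, `Λ n → ∞` and `tc n · (Λ n)² → ∞`.

Proof. For a level `L`, unboundedness on the cylinder of radius `√T` gives `(t₁, x₁)` with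
`0 < t₁ < T` and `‖u t₁ x₁‖ > 2 max(L, 0)`; the supremum `S` of `‖u‖` over `[0, t₁] × ℝ³` is
finite, and a point `(s₁, y)` of the slab with `‖u s₁ y‖ > S/2` is moved, by continuity of
`s ↦ ‖u s y‖` on `[0, T)`, to a time `tc ∈ (0, t₁)` keeping `‖u tc y‖ > S/2`; with `e = t₁ - tc`
the slab `[0, tc + e] = [0, t₁]` carries `‖u‖ ≤ S < 2 ‖u tc y‖`, and `‖u tc y‖ > S/2 > L`
(`exists_record_level`). Running this at the levels `max(n, B₀)`, `B₀` a bound of `‖u‖` on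
`[0, T/2] × ℝ³`, forces `tc n > T/2`, whence `Λ n > n → ∞` and `tc n Λ n² ≥ (T/2) Λ n² → ∞`.
-/

noncomputable section

set_option linter.dupNamespace false -- nested layout Summit.<S>.<Sub>, Sub = S (D-0017)

open Set MeasureTheory Filter Topology Metric Function

namespace Summit.NavierStokesRegularity.NavierStokesRegularity.Theorems.BoundedEnvelope

open Literature.Analysis Literature.Analysis.FluidPDE

/-- **One record level.** For `u` continuous on `[0, T) × ℝ³`, bounded on every closed sub-slab
`[0, t] × ℝ³` (`t < T`) and not backward bounded at `(T, x₀)`, and any level `L`, there is a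
record point `(tc, xc)`, `0 < tc`, with slack `e > 0`, `tc + e < T`, such that `L < ‖u tc xc‖`
and `‖u‖ ≤ 2 ‖u tc xc‖` on the slab `[0, tc + e] × ℝ³`. [folklore] -/
theorem exists_record_level {T : ℝ} (hT : 0 < T)
    {u : ℝ → EuclideanSpace ℝ (Fin 3) → EuclideanSpace ℝ (Fin 3)}
    (hcont : ContinuousOn (uncurry u) (Ico 0 T ×ˢ univ))
    (hbd : ∀ t < T, ∃ B : ℝ, ∀ s ∈ Icc 0 t, ∀ x, ‖u s x‖ ≤ B)
    {x₀ : EuclideanSpace ℝ (Fin 3)} (hnb : ¬ IsBackwardBoundedAt u T x₀) (L : ℝ) :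
    ∃ (tc : ℝ) (xc : EuclideanSpace ℝ (Fin 3)) (e : ℝ), 0 < tc ∧ 0 < e ∧ tc + e < T ∧
      L < ‖u tc xc‖ ∧ ∀ s ∈ Icc 0 (tc + e), ∀ x, ‖u s x‖ ≤ 2 * ‖u tc xc‖ := by
  -- a point of the backward cylinder `(0, T) × B(x₀, √T)` where `‖u‖ > 2 · max L 0`
  obtain ⟨t₁, ht₁, x₁, hx₁⟩ :
      ∃ t ∈ Ioo (T - Real.sqrt T ^ 2) T, ∃ x, 2 * max L 0 < ‖u t x‖ := by
    by_contra h
    push Not at h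
    exact hnb ⟨Real.sqrt T, Real.sqrt_pos.2 hT, 2 * max L 0, fun t ht x _ => h t ht x⟩
  rw [Real.sq_sqrt hT.le, sub_self] at ht₁
  -- the (finite) supremum of `‖u‖` over the slab `[0, t₁] × ℝ³`
  set A : Set ℝ :=
    (fun p : ℝ × EuclideanSpace ℝ (Fin 3) => ‖u p.1 p.2‖) '' (Icc 0 t₁ ×ˢ univ) with hA
  obtain ⟨B, hB⟩ := hbd t₁ ht₁.2
  have hAbdd : BddAbove A := by
    refine ⟨B, ?_⟩
    rintro _ ⟨⟨s, x⟩, ⟨hs, -⟩, rfl⟩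
    exact hB s hs x
  have hmemA : ∀ s ∈ Icc 0 t₁, ∀ x, ‖u s x‖ ∈ A := fun s hs x =>
    ⟨(s, x), ⟨hs, mem_univ _⟩, rfl⟩
  have hleS : ∀ s ∈ Icc 0 t₁, ∀ x, ‖u s x‖ ≤ sSup A := fun s hs x =>
    le_csSup hAbdd (hmemA s hs x)
  have ht₁A : ‖u t₁ x₁‖ ∈ A := hmemA t₁ ⟨ht₁.1.le, le_rfl⟩ x₁
  have ht₁S : ‖u t₁ x₁‖ ≤ sSup A := le_csSup hAbdd ht₁A
  have hL0 : 0 ≤ max L 0 := le_max_right _ _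
  have hSpos : 0 < sSup A := by linarith
  -- a near-maximum point `(s₁, y)` of the slab: `S / 2 < ‖u s₁ y‖`
  obtain ⟨a, haA, hgt⟩ := exists_lt_of_lt_csSup ⟨_, ht₁A⟩ (half_lt_self hSpos)
  obtain ⟨⟨s₁, y⟩, ⟨hs₁, -⟩, rfl⟩ := haA
  simp only at hgt
  -- continuity of `s ↦ ‖u s y‖` on `[0, T)`
  have hg : ContinuousOn (fun s : ℝ => ‖u s y‖) (Ico 0 T) := by
    have h1 : ContinuousOn (fun s : ℝ => (s, y)) (Ico 0 T) :=
      (Continuous.prodMk_left y).continuousOn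
    have h2 : MapsTo (fun s : ℝ => (s, y)) (Ico 0 T) (Ico 0 T ×ˢ univ) := fun s hs =>
      ⟨hs, mem_univ _⟩
    exact (hcont.comp h1 h2).norm
  have hs₁T : s₁ ∈ Ico 0 T := ⟨hs₁.1, hs₁.2.trans_lt ht₁.2⟩
  have hε : 0 < ‖u s₁ y‖ - sSup A / 2 := sub_pos.2 hgt
  obtain ⟨δ, hδ, hδ'⟩ := Metric.continuousWithinAt_iff.1 (hg.continuousWithinAt hs₁T) _ hε
  -- a time `tc ∈ (0, t₁)` within `δ` of `s₁`
  have hcl : s₁ ∈ closure (Ioo 0 t₁) := by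
    rw [closure_Ioo ht₁.1.ne]
    exact hs₁
  obtain ⟨tc, htc, hdist⟩ := Metric.mem_closure_iff.1 hcl δ hδ
  have htcT : tc ∈ Ico 0 T := ⟨htc.1.le, htc.2.trans ht₁.2⟩
  have hclose : dist ‖u tc y‖ ‖u s₁ y‖ < ‖u s₁ y‖ - sSup A / 2 :=
    hδ' htcT (by rwa [dist_comm])
  have hgt' : sSup A / 2 < ‖u tc y‖ := by
    rw [Real.dist_eq] at hclose
    have := (abs_sub_lt_iff.1 hclose).2
    linarith
  refine ⟨tc, y, t₁ - tc, htc.1, sub_pos.2 htc.2, by linarith [ht₁.2], ?_, ?_⟩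
  · have h2 : L ≤ max L 0 := le_max_left _ _
    linarith
  · intro s hs x
    have hs' : s ∈ Icc 0 t₁ := ⟨hs.1, by linarith [hs.2]⟩
    have := hleS s hs' x
    linarith

/-- **stub Z1 — `stub_recordSequence`.** Record points of a field `u` continuous on
`[0,T) × ℝ³`, bounded on every closed sub-slab `[0,t] × ℝ³`, `t < T`, but unbounded on every
backward parabolic cylinder with vertex `(T, x₀)`: base times `tc n`, centres `xc n`, levels
`Λ n = ‖u (tc n) (xc n)‖ → ∞`, slack `e n > 0` with `tc n + e n < T`, such that `‖u‖ ≤ 2 Λ n` on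
`[0, tc n + e n] × ℝ³` and `tc n · (Λ n)² → ∞`. The levels are chosen above `max(n, B₀)`, `B₀`
a bound of `‖u‖` on `[0, T/2] × ℝ³`, so that `tc n > T/2`. [folklore] -/
theorem stub_recordSequence :
    ∀ (T : ℝ), 0 < T →
      ∀ (u : ℝ → EuclideanSpace ℝ (Fin 3) → EuclideanSpace ℝ (Fin 3)),
        ContinuousOn (uncurry u) (Set.Ico 0 T ×ˢ Set.univ) →
        (∀ t < T, ∃ B : ℝ, ∀ s ∈ Set.Icc 0 t, ∀ x, ‖u s x‖ ≤ B) →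
        ∀ x₀ : EuclideanSpace ℝ (Fin 3), ¬ IsBackwardBoundedAt u T x₀ →
        ∃ (tc : ℕ → ℝ) (xc : ℕ → EuclideanSpace ℝ (Fin 3)) (Λ e : ℕ → ℝ),
          (∀ n, 0 < tc n) ∧ (∀ n, 0 < e n) ∧ (∀ n, tc n + e n < T) ∧ (∀ n, 0 < Λ n) ∧
          (∀ n, Λ n = ‖u (tc n) (xc n)‖) ∧
          (∀ n, ∀ s ∈ Set.Icc 0 (tc n + e n), ∀ x, ‖u s x‖ ≤ 2 * Λ n) ∧
          Tendsto Λ atTop atTop ∧ Tendsto (fun n => tc n * Λ n ^ 2) atTop atTop := by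
  intro T hT u hcont hbd x₀ hnb
  -- a bound `B₀` of `‖u‖` on the first half `[0, T/2] × ℝ³`
  obtain ⟨B₀, hB₀⟩ := hbd (T / 2) (half_lt_self hT)
  -- level-`n` records, above `max n B₀`
  choose tc xc e htc he hteT hgt hle using
    fun n : ℕ => exists_record_level hT hcont hbd hnb (max (n : ℝ) B₀)
  have hΛn : ∀ n : ℕ, (n : ℝ) < ‖u (tc n) (xc n)‖ := fun n => (le_max_left _ _).trans_lt (hgt n)
  have hΛpos : ∀ n, 0 < ‖u (tc n) (xc n)‖ := fun n => (Nat.cast_nonneg n).trans_lt (hΛn n)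
  -- records above `B₀` happen after time `T/2`
  have htc2 : ∀ n, T / 2 < tc n := by
    intro n
    by_contra h
    push Not at h
    have h1 : ‖u (tc n) (xc n)‖ ≤ B₀ := hB₀ (tc n) ⟨(htc n).le, h⟩ (xc n)
    have h2 : B₀ < ‖u (tc n) (xc n)‖ := (le_max_right _ _).trans_lt (hgt n)
    linarith
  have hΛ : Tendsto (fun n => ‖u (tc n) (xc n)‖) atTop atTop :=
    tendsto_atTop_mono (fun n => (hΛn n).le) tendsto_natCast_atTop_atTop
  refine ⟨tc, xc, fun n => ‖u (tc n) (xc n)‖, e, htc, he, hteT, hΛpos, fun n => rfl, hle, hΛ, ?_⟩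
  -- `tc n · Λ n² ≥ (T/2) · Λ n² → ∞`
  have h2 : Tendsto (fun n => T / 2 * ‖u (tc n) (xc n)‖ ^ 2) atTop atTop :=
    ((tendsto_pow_atTop two_ne_zero).comp hΛ).const_mul_atTop (half_pos hT)
  refine tendsto_atTop_mono (fun n => ?_) h2
  show T / 2 * ‖u (tc n) (xc n)‖ ^ 2 ≤ tc n * ‖u (tc n) (xc n)‖ ^ 2
  exact mul_le_mul_of_nonneg_right (htc2 n).le (sq_nonneg _)

end Summit.NavierStokesRegularity.NavierStokesRegularity.Theorems.BoundedEnvelope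

end
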